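import Summits.QuantumFields.BalabanUV.T4Continuum.Support.OutputRateFunctionalTablesFamily

/-!
# OutputRateFunctionalTablesPointwise — PER-BACKGROUND slots (the F-road's own data: operators AT a background, a function-table
# insertion read AT a background, Bałaban's ONE functional) on the EXISTING kernel through the re-indexed carriers (NE5 crux O1,
# owner design item R48-F; part 3 of `OutputRateFunctionalTables`; cell `pub-balaban`, T⁴ fan-out; `HOME/CLAIMS.log` l.15388 (R48),
# INTENT l.15569 ∕ l.15760, leaf-06 GO + F1–F3 l.15813, substrate-typer (η2) l.15841, owner RULING R49 l.16073: Road D OF RECORD)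

Unit `b2b-balaban-t4-ne5-formalise-leaf-02` (NE5 formalisation swarm, leaf prover 02, gen 16).  Summits-side NEW WORK under the
LEAN PLACEMENT RULE (cell modelling + bookkeeping over ABSTRACT carriers; NOT a Literature module; nothing printed is asserted,
no `[cite:]` tag, no `Prop`-valued fact is minted — trigger c3).  HONEST FRAMING: rung (B)+1 of the FINITE-VOLUME T⁴ continuum
programme — NOT infinite volume, NOT a mass gap, NOT the Clay problem, NOT a proof of NE5 (NOT PRINTED; cell GAPS G-t4-U3-1).
HONEST DEPENDENCY (cell line, verbatim): continuum YM on T⁴ ⇐ BetaPertH ∧ nine spine estimates (0/9 proved); BetaPertH ⇐ (D1) ∧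
(D4) ∧ CAP+tail; G-an2-4 gates asym, D1 and NE2/3/4.

WHY.  The owner's F-road (R48-F as typed, l.15388) keeps the step PER BACKGROUND — operators `opB g U k` AT the background, an
insertion `insOpB g U k` READING THE FUNCTION TABLE of the earlier terms NEAR the background, Bałaban's ONE functional producing
`𝐄^{(k+1)}(X, U)` ([Balaban1988RG2Cluster] (2.13) p. 14 with Lemma 1 (1.33) p. 9) — and would pay for it with an `F`-twin of the
kernel.  Parts 1–2 showed the re-indexed road needs no twin but charges the instancer background FAMILIES.  This part closes the
circle ([folklore] bookkeeping, NO estimate): `PointwiseSlots C 𝒰 Op Hist` IS the F-road's per-background data (with `F := (𝒰 → ℝ)`,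
tables `C.Dom × 𝒰 → ℝ`), plus ONE displayed side condition — the two OPERATOR families bounded uniformly over the chart (the printed
uniformity of [II] (1.5) p. 3 in the background; `memℓp_infty`) — and NOTHING asked of the insertions (their families are read
through part 2's `famOf`: verbatim where bounded, junk where not; the kernel's binders only meet `B`-close pairs,
`norm_famOf_sub_famOf_le`); `toFamilySlots` ∕ `toStepModel` extend it along the chart, and
* `representsB_of_pointwise` ∕ `representsA_of_pointwise`: THE PRINT'S SHAPE — for every chart point `u`,
  `EB g (ρ u) X = Re Out k (opB g k u) (insB g k (uncurry (funTableB ρ EB g)) u) X` — gives the kernel's `RepresentsB` of the lift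
  (side condition: the ONE inserted family of record, run B's own function table, bounded over the chart); `inBase_of_pointwise`;
* `operatorRate_of_pointwise` (W1 = row NE2's per-background rate, uniformly over the chart), `outputEnvelope_of_pointwise` (W2 from
  the pointwise envelope around every admissible per-background datum), `insertionDamped_of_pointwise` (MI-3a),
  `insertionRate_of_pointwise` — each kernel binder from its PER-BACKGROUND form;
* **`ne5_of_pointwiseSlots`** — THE F-ROAD'S END ON THE EXISTING KERNEL: every hypothesis PER BACKGROUND (uniformly over the chart)
  + the two runs' decay bounds over `C` + the kernel's smallness ⟹ `T4OutputRate.NE5 EA EB W κ θ C₅` over the ORIGINAL carriers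
  (chart nonempty, onto the run-B backgrounds), by part 1's `ne5_of_stepModel_lift`.  No kernel twin, no END twin.
WHAT IS NOT HERE.  No instance on Bałaban's objects (the substrate's `slotsOfRecord` AT a chart point, `InsLetters.ofFam` —
substrate-p1 ON EVENT, (η2)); the function-table insertion is a PARAMETER (its construction from (1.33) is R48-F proper); no
estimate of [II].  0 sorry; axioms ⊆ {propext, Classical.choice, Quot.sound}.
-/

noncomputable section

open scoped BigOperators ENNReal
open Finset Function Metric Set

namespace Summit.QuantumFields.BalabanUV.T4Continuum.OutputRateFunctionalTablesPointwise

open Literature.MathematicalPhysics.QuantumFieldTheory.Balaban1983to89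
open Literature.MathematicalPhysics.QuantumFieldTheory.Balaban1983to89.T4OutputRate
open Literature.MathematicalPhysics.QuantumFieldTheory.Balaban1983to89.T4InputCauchyRateData
open Summit.QuantumFields.BalabanUV.T4Continuum.OutputRateFunctionalTables
open Summit.QuantumFields.BalabanUV.T4Continuum.OutputRateFunctionalTablesFamily

variable {C : Carriers} {𝒰 : Type} {Op Hist : Type*} [NormedAddCommGroup Op] [NormedSpace ℂ Op] [NormedAddCommGroup Hist]
  [NormedSpace ℂ Hist]

/-! ## §1 Per-background slots and their extension along the chart -/

/-- [folklore] HYPOTHESIS-CARRYING DATA: PER-BACKGROUND («pointwise») slots on the chart — for every chart point `u`: the two runs'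
operator data AT `u`, the two runs' insertions of a FUNCTION table read AT `u`, the one-run admissible class AT `u`; Bałaban's ONE
functional and the margins; and UNIFORM BOUNDEDNESS OF THE TWO OPERATOR FAMILIES over the chart (membership in `ℓ^∞` — the printed
uniformity of the (1.5) p. 3 bounds in the background; a TYPE-level side condition, displayed).  NO boundedness is asked of the
insertions: their families are read through `famOf` (verbatim where bounded, junk where not — the kernel's binders only meet
bounded pairs, `norm_famOf_sub_famOf_le`), and the representation ∕ admissibility hypotheses below carry the boundedness of the ONE
inserted family of record (the runs' own function tables) as a displayed side condition.  This is exactly the data of the owner's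
F-road (R48-F: «`insOpB g U k` reading the function near `U`», operators and output per background) with `F := (𝒰 → ℝ)`. -/
structure PointwiseSlots (C : Carriers) (𝒰 : Type) (Op Hist : Type*) [NormedAddCommGroup Op] [NormedSpace ℂ Op]
    [NormedAddCommGroup Hist] [NormedSpace ℂ Hist] where
  /-- the pointwise one-step output functional at step `k` -/
  Out : ℕ → Op → Hist → C.Dom → ℂ
  /-- run A's operator data at step `k` AT the chart point `u` -/
  opA : (ℕ → ℝ) → ℕ → 𝒰 → Op
  /-- run B's operator data at step `k` AT the chart point `u` -/
  opB : (ℕ → ℝ) → ℕ → 𝒰 → Op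
  /-- run A's insertion of a function table, read AT the chart point `u` -/
  insA : (ℕ → ℝ) → ℕ → (C.Dom × 𝒰 → ℝ) → 𝒰 → Hist
  /-- run B's insertion of a function table, read AT the chart point `u` -/
  insB : (ℕ → ℝ) → ℕ → (C.Dom × 𝒰 → ℝ) → 𝒰 → Hist
  /-- the one-run admissible class AT the chart point `u` -/
  Base : ℕ → (ℕ → ℝ) → 𝒰 → Set (Op × Hist)
  /-- operator margin -/
  rOp : ℕ → ℝ
  /-- history margin -/
  rHist : ℕ → ℝ
  rOp_pos : ∀ k, 0 < rOp k
  rHist_pos : ∀ k, 0 < rHist k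
  /-- run A's operators are bounded uniformly over the chart -/
  opA_bdd : ∀ g k, BddAbove (Set.range fun u => ‖opA g k u‖)
  /-- run B's operators are bounded uniformly over the chart -/
  opB_bdd : ∀ g k, BddAbove (Set.range fun u => ‖opB g k u‖)

namespace PointwiseSlots

variable (P : PointwiseSlots C 𝒰 Op Hist)

/-- [folklore] THE EXTENSION ALONG THE CHART: per-background slots as family slots (operator families by the displayed uniform
bounds, inserted families through `famOf`; a family is admissible iff it is admissible at every chart point). -/
def toFamilySlots : FamilySlots C 𝒰 Op Hist where
  Out k o h p := P.Out k o h p.1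
  opA g k := ⟨fun u => P.opA g k u, memℓp_infty (P.opA_bdd g k)⟩
  opB g k := ⟨fun u => P.opB g k u, memℓp_infty (P.opB_bdd g k)⟩
  insA g k t := famOf (P.insA g k t)
  insB g k t := famOf (P.insB g k t)
  Base k g := {p | ∀ u, (p.1 u, p.2 u) ∈ P.Base k g u}
  rOp := P.rOp
  rHist := P.rHist
  rOp_pos := P.rOp_pos
  rHist_pos := P.rHist_pos

/-- [folklore] The step model over the re-indexed carriers of per-background slots. -/
abbrev toStepModel : StepModel (paramCarriers C 𝒰) (Fam 𝒰 Op) (Fam 𝒰 Hist) := P.toFamilySlots.toStepModel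

/-- [folklore] **`RepresentsB` FROM THE PRINT'S SHAPE**: if run B's inserted function-table family is bounded over the chart and, for
every chart point `u`, run B's term at `(X, ρ u)` is the real part of Bałaban's functional at run B's operators AT `u` and at run B's
FUNCTION TABLE inserted AT `u` ([II] (2.13) with (1.33)), then the model represents run B's lift. -/
theorem representsB_of_pointwise {ρ : 𝒰 → C.BgB} {EB : Functional C C.BgB} {W : Set (ℕ → ℝ)}
    (hbd : ∀ g ∈ W, ∀ k, BddAbove (Set.range fun u => ‖P.insB g k (uncurry (funTableB ρ EB g)) u‖))
    (h : ∀ g ∈ W, ∀ (X : C.Dom) (u : 𝒰), EB g (ρ u) X =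
      (P.Out (C.scale X) (P.opB g (C.scale X) u) (P.insB g (C.scale X) (uncurry (funTableB ρ EB g)) u) X).re) :
    P.toStepModel.RepresentsB (liftB ρ EB) W := by
  intro g hg _ p
  show EB g (ρ p.2) p.1 =
    (P.Out (C.scale p.1) (P.opB g (C.scale p.1) p.2) (famOf (P.insB g (C.scale p.1) (uncurry (funTableB ρ EB g))) p.2) p.1).re
  rw [famOf_apply (hbd g hg _)]
  exact h g hg p.1 p.2

/-- [folklore] The same for run A. -/
theorem representsA_of_pointwise {ρ : 𝒰 → C.BgB} {EA : Functional C C.BgA} {W : Set (ℕ → ℝ)}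
    (hbd : ∀ g ∈ W, ∀ k, BddAbove (Set.range fun u => ‖P.insA g k (uncurry (funTableA ρ EA g)) u‖))
    (h : ∀ g ∈ W, ∀ (X : C.Dom) (u : 𝒰), EA g (C.transport (ρ u)) X =
      (P.Out (C.scale X) (P.opA g (C.scale X) u) (P.insA g (C.scale X) (uncurry (funTableA ρ EA g)) u) X).re) :
    P.toStepModel.RepresentsA (liftA ρ EA) W := by
  intro g hg _ p
  show EA g (C.transport (ρ p.2)) p.1 =
    (P.Out (C.scale p.1) (P.opA g (C.scale p.1) p.2) (famOf (P.insA g (C.scale p.1) (uncurry (funTableA ρ EA g))) p.2) p.1).re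
  rw [famOf_apply (hbd g hg _)]
  exact h g hg p.1 p.2

/-- [folklore] `InBase` from admissibility AT every chart point (run B's inserted family bounded over the chart). -/
theorem inBase_of_pointwise {ρ : 𝒰 → C.BgB} {EB : Functional C C.BgB} {W : Set (ℕ → ℝ)}
    (hbd : ∀ g ∈ W, ∀ k, BddAbove (Set.range fun u => ‖P.insB g k (uncurry (funTableB ρ EB g)) u‖))
    (h : ∀ k, ∀ g ∈ W, ∀ u, (P.opB g k u, P.insB g k (uncurry (funTableB ρ EB g)) u) ∈ P.Base k g u) :
    P.toStepModel.InBase (liftB ρ EB) W := by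
  intro k g hg _ u
  show (P.opB g k u, famOf (P.insB g k (uncurry (funTableB ρ EB g))) u) ∈ P.Base k g u
  rw [famOf_apply (hbd g hg k)]
  exact h k g hg u

/-- [folklore] W1 for per-background slots: the per-background operator rate uniformly over the chart (nonempty chart). -/
theorem operatorRate_of_pointwise [Nonempty 𝒰] {W : Set (ℕ → ℝ)} {δ θ : ℝ}
    (h : ∀ k, ∀ g ∈ W, ∀ u : 𝒰, ‖P.opA g k u - P.opB g k u‖ ≤ δ * θ ^ k * P.rOp k) : P.toStepModel.OperatorRate W δ θ :=
  (P.toFamilySlots.operatorRate_iff_pointwise W δ θ).2 h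

/-- [folklore] W2 for per-background slots: the pointwise envelope around every admissible per-background datum. -/
theorem outputEnvelope_of_pointwise {W : Set (ℕ → ℝ)} {κ G : ℝ}
    (h : ∀ k, ∀ g ∈ W, ∀ u, ∀ q ∈ P.Base k g u, ∀ X : C.Dom, C.scale X = k →
      DifferentiableOn ℂ (fun z : Op × Hist => P.Out k z.1 z.2 X) (closedBall q.1 (P.rOp k) ×ˢ closedBall q.2 (P.rHist k)) ∧
        ∀ z ∈ closedBall q.1 (P.rOp k) ×ˢ closedBall q.2 (P.rHist k), ‖P.Out k z.1 z.2 X‖ ≤ G * Real.exp (-(κ * C.d X))) :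
    P.toStepModel.OutputEnvelope W κ G :=
  P.toFamilySlots.outputEnvelope_of_pointwise fun k g hg _ hp X u hX => h k g hg u _ (hp u) X hX

/-- [folklore] MI-3a for per-background slots from its per-background form (nonempty chart; `famOf` is met only on `B`-close pairs). -/
theorem insertionDamped_of_pointwise [Nonempty 𝒰] {W : Set (ℕ → ℝ)} {κ c ω : ℝ}
    (h : ∀ k, ∀ g ∈ W, ∀ (t t' : C.Dom × 𝒰 → ℝ) (D : ℕ → ℝ), (∀ j < k, 0 ≤ D j) →
      (∀ Y, C.scale Y < k → ∀ u, |t (Y, u) - t' (Y, u)| ≤ D (C.scale Y) * Real.exp (-(κ * C.d Y))) →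
        ∀ u, ‖P.insA g k t u - P.insA g k t' u‖ ≤ P.rHist k * (c * ∑ j ∈ range k, ω ^ (k - j) * D j)) :
    P.toStepModel.InsertionDamped W κ c ω := by
  rw [insertionDamped_param_iff]
  intro k g hg t t' D hD hb
  exact norm_famOf_sub_famOf_le (h k g hg t t' D hD hb)

/-- [folklore] The two runs' insertion rate for per-background slots from its per-background form (nonempty chart). -/
theorem insertionRate_of_pointwise [Nonempty 𝒰] {W : Set (ℕ → ℝ)} {κ E₀ δ' θ : ℝ}
    (h : ∀ k, ∀ g ∈ W, ∀ (t : C.Dom × 𝒰 → ℝ), (∀ Y u, |t (Y, u)| ≤ E₀ * Real.exp (-(κ * C.d Y))) →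
      ∀ u, ‖P.insA g k t u - P.insB g k t u‖ ≤ δ' * θ ^ k * P.rHist k) :
    P.toStepModel.InsertionRate W κ E₀ δ' θ := by
  intro k g hg _ t ht
  exact norm_famOf_sub_famOf_le (h k g hg t fun Y u => ht (Y, u))

/-- [folklore] **THE F-ROAD'S END ON THE EXISTING KERNEL**: per-background slots whose PER-BACKGROUND hypotheses hold uniformly
over the chart — the print's representation of the two runs (function tables READ, at every `u`; the two inserted families of
record bounded over the chart), admissibility at every `u`, the output envelope of Bałaban's functional around every admissible
per-background datum, the operator rate AT every `u` (row NE2's currency), the insertion rate and the damped-Lipschitz binder AT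
every `u` — together with the two runs' decay bounds over `C` and the kernel's smallness give `T4OutputRate.NE5 EA EB W κ θ C₅`
over the ORIGINAL carriers (chart nonempty and onto).  No kernel twin. -/
theorem ne5_of_pointwiseSlots [Nonempty 𝒰] {ρ : 𝒰 → C.BgB} (hρ : Surjective ρ) {EA : Functional C C.BgA}
    {EB : Functional C C.BgB} {W : Set (ℕ → ℝ)} {κ G E₀ δ δ' θ c ω : ℝ}
    (hbdA : ∀ g ∈ W, ∀ k, BddAbove (Set.range fun u => ‖P.insA g k (uncurry (funTableA ρ EA g)) u‖))
    (hbdB : ∀ g ∈ W, ∀ k, BddAbove (Set.range fun u => ‖P.insB g k (uncurry (funTableB ρ EB g)) u‖))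
    (hrA : ∀ g ∈ W, ∀ (X : C.Dom) (u : 𝒰), EA g (C.transport (ρ u)) X =
      (P.Out (C.scale X) (P.opA g (C.scale X) u) (P.insA g (C.scale X) (uncurry (funTableA ρ EA g)) u) X).re)
    (hrB : ∀ g ∈ W, ∀ (X : C.Dom) (u : 𝒰), EB g (ρ u) X =
      (P.Out (C.scale X) (P.opB g (C.scale X) u) (P.insB g (C.scale X) (uncurry (funTableB ρ EB g)) u) X).re)
    (hbase : ∀ k, ∀ g ∈ W, ∀ u, (P.opB g k u, P.insB g k (uncurry (funTableB ρ EB g)) u) ∈ P.Base k g u)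
    (henv : ∀ k, ∀ g ∈ W, ∀ u, ∀ q ∈ P.Base k g u, ∀ X : C.Dom, C.scale X = k →
      DifferentiableOn ℂ (fun z : Op × Hist => P.Out k z.1 z.2 X) (closedBall q.1 (P.rOp k) ×ˢ closedBall q.2 (P.rHist k)) ∧
        ∀ z ∈ closedBall q.1 (P.rOp k) ×ˢ closedBall q.2 (P.rHist k), ‖P.Out k z.1 z.2 X‖ ≤ G * Real.exp (-(κ * C.d X)))
    (hdA : DecayBound EA W G κ) (hdB : DecayBound EB W E₀ κ) (hE₀ : E₀ ≤ G)
    (hop : ∀ k, ∀ g ∈ W, ∀ u : 𝒰, ‖P.opA g k u - P.opB g k u‖ ≤ δ * θ ^ k * P.rOp k)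
    (hins : ∀ k, ∀ g ∈ W, ∀ (t : C.Dom × 𝒰 → ℝ), (∀ Y u, |t (Y, u)| ≤ E₀ * Real.exp (-(κ * C.d Y))) →
      ∀ u, ‖P.insA g k t u - P.insB g k t u‖ ≤ δ' * θ ^ k * P.rHist k)
    (hdamp : ∀ k, ∀ g ∈ W, ∀ (t t' : C.Dom × 𝒰 → ℝ) (D : ℕ → ℝ), (∀ j < k, 0 ≤ D j) →
      (∀ Y, C.scale Y < k → ∀ u, |t (Y, u) - t' (Y, u)| ≤ D (C.scale Y) * Real.exp (-(κ * C.d Y))) →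
        ∀ u, ‖P.insA g k t u - P.insA g k t' u‖ ≤ P.rHist k * (c * ∑ j ∈ range k, ω ^ (k - j) * D j))
    (hG : 0 ≤ G) (hδ : 0 ≤ δ + δ') (hc : 0 ≤ c) (hω : 0 ≤ ω) (hsmall : (1 + 4 * G * c) * ω < θ) :
    NE5 EA EB W κ θ (4 * G * (δ + δ') * (θ - ω) / (θ - (1 + 4 * G * c) * ω)) :=
  ne5_of_stepModel_lift P.toStepModel hρ (P.representsA_of_pointwise hbdA hrA) (P.representsB_of_pointwise hbdB hrB)
    (P.inBase_of_pointwise hbdB hbase) (P.outputEnvelope_of_pointwise henv) hdA hdB hE₀ (P.operatorRate_of_pointwise hop)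
    (P.insertionRate_of_pointwise hins) (P.insertionDamped_of_pointwise hdamp) hG hδ hc hω hsmall

end PointwiseSlots

end Summit.QuantumFields.BalabanUV.T4Continuum.OutputRateFunctionalTablesPointwise

end
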